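import Summits.QuantumFields.YangMills.Theorems.BalabanUVNodesN20ClassLawConditionalHybridBoundMarginals
import Summits.QuantumFields.YangMills.Theorems.BalabanUVNodesN20InhomogeneousBlockCaricature

/-!
# BalabanUVNodes ∕ N20·N19′·N21 — THE CONDITIONAL LETTER IS NECESSARY TERMWISE, HENCE EXACT AT A BOUNDED WINDOW (FILE W): if SOME dials give node U5's `HybridNE7` on class
# weights over the large-field configurations of `n_K` blocks, then EVERY mass-weighted conditional two-run discrepancy of the marginal towers is `≤ 2ρ_K` with dag-n20-w4's summable
# class-law radius `ρ_K`, so at a window of bounded size (`n_K ≤ N`) the summed conditional letter of FILES T∕V is NECESSARY as well as (with the Target) SUFFICIENT — dependence-free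

Cell `pub-ymgap` (HUMAN RULING D-0062 Track A; work-bound push D-0149, director-ym №197), width seat `pub-ymgap-dag-n20-w1` (gen 7) on node N20 = NE7b; key item of this
seat's payload K3⁷ `SpineGivenEndpointR13SepCoPH` = stmt-QuantumFields-20544 (ASIDE; lineage of K3⁸ `SpineGivenEndpointR13SepCoPHV` = stmt-QuantumFields-27366, skeleton v6
b4e55110ab73e679 UNTOUCHED; `--kind proof --supports 20544 --as helper`, MIS-KEY rule R463 (4)(a)); COUNT-NEUTRAL.  Bus: CLAIM-27 ∕ INTENT-32.
THEOREMS ONLY (0 def ∕ instance ∕ notation ∕ sorry); imports this seat's FILE V `…N20ClassLawConditionalHybridBoundMarginals` (through it FILE T p639220, dag-n20-w4 p609004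
`exists_tvRadius_of_hybridNE7` ∕ `exists_hybridNE7_of_target_of_classLawTV`, FILE A `abs_sub_le_half_sum_abs` — BY NAME).

WHY.  FILES T∕U∕V made the class-law half of K3 stub 2 follow — with NO independence — from node U5's Target plus a summable tower of mass-weighted CONDITIONAL two-run
discrepancies (per block ∕ per dial step).  Is that letter merely sufficient?  NO: each of its terms is NECESSARY.  If some dials give `HybridNE7`, dag-n20-w4's
`exists_tvRadius_of_hybridNE7` bounds EVERY class-set gap of the normalised class laws by a summable `ρ_K < 1`; the two marginal events «the first `i+1` blocks read `S ∪ {i}`» and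
«the first `i` blocks read `S`» ARE class sets, and run B's marginal is monotone along the tower, so the mass-weighted conditional term obeys (§1 `condGap_le_two_mul_of_gaps`)
`|a₁·b₀ − b₁·a₀| ∕ b₀ ≤ 2ρ_K` (`a`, `b` the two runs' normalised marginals).  Summing over the `Σ_{i<n} 2^i ≤ n·2^n` terms (§2 ★★ `condGapSum_le_of_classSetGap`): the whole conditional sum
at `(K, t)` is `≤ 2·n_K·2^{n_K}·ρ_K`.  Along `K` (§3): ★★★ `exists_summable_condGapSum_of_exists_hybridNE7` — dials ⇒ a summable `γ` bounding the conditional sum at every `|t| ≤ l₀`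
whenever the block count is bounded (`n_K ≤ N`; constant `2N·2^N`); and the converse road, tower-free: ★★★ `exists_hybridNE7_of_target_of_condGapSum` — positive weights, E1∕E2, Target,
a bound `γ_K` on HALF the normalised conditional sum of FILE V at every `|t| ≤ l₀`, `γ` summable, `γ_K < 1` ⇒ SOME shells give `HybridNE7 … ∅ 0 shA shB γ δ`.  So AT A WINDOW OF
BOUNDED SIZE the dependence-free conditional letter is, given the Target, EQUIVALENT to stub 2's dials up to the constant `2N·2^N` and the `< 1` normalisation of the radius
(§3 ★★ `classSetGapLetter_iff_condGapSumLetter_of_boundedBlocks`: at bounded windows the summable CLASS-SET-GAP letter of dag-n20-w4's characterisation and the summable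
CONDITIONAL-SUM letter are EQUIVALENT, literally, with no `< 1` and no Target involved).
LOCATED READING (hypothesis SHAPES; for the plan's window key, CRIT-1, cdisprove-to-be): at a bounded window the class-law content of stub 2 IS «the two runs' conditional
large-field laws, level by level given the coarser levels (block by block given the earlier blocks), agree on average, summably in the cutoff» — nothing weaker can serve
(necessity is TERMWISE: one level, one past configuration with an unsummable mass-weighted two-run conditional gap kills every dial), nothing stronger is needed.  Independence
(the caricature of FILES A–S) was never the point; conditioning is.  Whether Bałaban's densities supply the letter is NOT claimed.

v1.1 (gen 7, APPEND-ONLY: the eight v1.0 declarations byte-identical; one import added — this seat's FILE Q p635927 for `sum_abs_sub_le_two_mul_of_classSetGap_le`; §4 appended):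
THE NECESSITY CONSTANT IS LINEAR IN THE WINDOW SIZE — per level the `2^i` conditional terms are controlled TOGETHER by data processing (`sum_marginal_abs_sub_le_l1`,
`sum_marginal_insert_abs_sub_le_l1`; each term `≤ |a₁−b₁| + |a₀−b₀|`, `condGap_le_abs_sub_add_abs_sub`), so the conditional sum is `≤ 2n·ℓ¹ ≤ 4n·ρ` (★★ `condGapSum_le_linear_of_classSetGap`)
and SOME dials ⇒ `condsum(K,t) ≤ 4·n_K·ρ_K` for ANY block counts (★★★ `exists_radius_condGapSum_le_linear_of_exists_hybridNE7`; v1.0's `2n_K·2^{n_K}` was the crude count).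

HONEST FRAMING.  [folklore] finite-sum probability on hypothesis SHAPES; nothing read at the record (`classSet₁₃ ∕ weightA₁₃ ∕ weightB₁₃` untouched; (LS)∕(XG′)∕(SAT′) and the regime AT
THE RECORD UNDECIDED); proves NO estimate of Bałaban's; refutes NO registered stub; nothing of Bałaban's asserted or instantiated.  NE7 ∕ NE7b ∕ NE7c NOT PRINTED for `d = 4`, NOT
proved; N19 ∕ N20 ∕ N21 NOT discharged; K3⁸ ∕ K3⁷ OPEN; counts unmoved (typed 28∕28 · discharged 5∕27); no count claim.  One finite `𝕋⁴_{L^K}` programme at fixed `ε = L^{−K}`, Bałaban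
AS PRINTED; the YM mass gap (Clay) is NOT proved by any of this — R4 closes the conditional finite-𝕋⁴ rung `BalabanLadder.UV` only; NOT ℝ⁴, NOT OS.  No decl carries a cite tag.
-/

noncomputable section

open Finset
open Literature.MathematicalPhysics.QuantumFieldTheory.Balaban1983to89
open Literature.MathematicalPhysics.QuantumFieldTheory.Balaban1983to89.T4MatchingAssembly (HybridNE7)
open Summit.QuantumFields.BalabanUV.T4Continuum.Spine.NE7 (Target)
open Summit.QuantumFields.YangMills.BalabanUVNodes.N20BlockCaricatureAffinity (abs_sub_le_half_sum_abs)
open Summit.QuantumFields.YangMills.BalabanUVNodes.N20HybridClassLawCharacterisation (exists_tvRadius_of_hybridNE7 exists_hybridNE7_of_target_of_classLawTV)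
open Summit.QuantumFields.YangMills.BalabanUVNodes.N20ClassLawConditionalHybridBoundMarginals

namespace Summit.QuantumFields.YangMills.BalabanUVNodes.N20ClassLawConditionalWindowCriterion

/-! ## §1 One term: two class-set gaps and monotonicity of run B's marginal bound the mass-weighted conditional discrepancy -/

/-- **ONE TERM** [folklore]: if `|a₁ − b₁| ≤ ρ`, `|a₀ − b₀| ≤ ρ` and `0 ≤ b₁ ≤ b₀`, then `|a₁·b₀ − b₁·a₀| ∕ b₀ ≤ 2ρ` (`a₁b₀ − b₁a₀ = (a₁ − b₁)b₀ + b₁(b₀ − a₀)`; the quotient is `0` when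
`b₀ = 0`). -/
theorem condGap_le_two_mul_of_gaps {a₀ a₁ b₀ b₁ ρ : ℝ} (h1 : |a₁ - b₁| ≤ ρ) (h0 : |a₀ - b₀| ≤ ρ) (hb1 : 0 ≤ b₁) (hb10 : b₁ ≤ b₀) :
    |a₁ * b₀ - b₁ * a₀| / b₀ ≤ 2 * ρ := by
  have hρ : 0 ≤ ρ := (abs_nonneg _).trans h1
  rcases (hb1.trans hb10).eq_or_lt with hb0 | hb0
  · rw [← hb0, div_zero]; linarith
  · rw [div_le_iff₀ hb0]
    calc |a₁ * b₀ - b₁ * a₀| = |(a₁ - b₁) * b₀ + b₁ * (b₀ - a₀)| := by ring_nf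
      _ ≤ |(a₁ - b₁) * b₀| + |b₁ * (b₀ - a₀)| := abs_add_le _ _
      _ = |a₁ - b₁| * b₀ + b₁ * |a₀ - b₀| := by rw [abs_mul, abs_mul, abs_of_pos hb0, abs_of_nonneg hb1, abs_sub_comm b₀ a₀]
      _ ≤ ρ * b₀ + b₀ * ρ := add_le_add (mul_le_mul_of_nonneg_right h1 hb0.le) (mul_le_mul hb10 h0 (abs_nonneg _) (hb1.trans hb10))
      _ = 2 * ρ * b₀ := by ring

/-! ## §2 At one scale: a class-set gap bound `ρ` controls the whole conditional sum of the marginal towers -/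

section OneScale

variable (n : ℕ) (P Q : Finset ℕ → ℝ)

/-- Run B's marginal is MONOTONE along the tower: `M^{i+1}(S ∪ {i}) ≤ M^i(S)` (consistency + non-negativity, FILE V). [bookkeeping] -/
theorem marginal_succ_insert_le (hQ : ∀ R ⊆ Finset.range n, 0 ≤ Q R) {i : ℕ} {S : Finset ℕ} (hS : S ⊆ Finset.range i) :
    ∑ R ∈ (Finset.range n).powerset.filter (fun R => R ∩ Finset.range (i + 1) = insert i S), Q R ≤
      ∑ R ∈ (Finset.range n).powerset.filter (fun R => R ∩ Finset.range i = S), Q R := by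
  rw [marginal_consistent n Q hS]
  linarith [marginal_nonneg n Q hQ (i + 1) S]

/-- ★★ **THE CONDITIONAL SUM IS CONTROLLED BY THE CLASS-SET GAPS** [folklore ∕ bookkeeping]: for non-negative `P, Q` on `(range n).powerset` whose every class-set gap is `≤ ρ`
(`|Σ_𝒮 P − Σ_𝒮 Q| ≤ ρ` for all `𝒮 ⊆ (range n).powerset`), the mass-weighted conditional sum of FILE V obeys
`Σ_{i<n} Σ_{S⊆range i} |M_P^{i+1}(S∪{i})·M_Q^i(S) − M_Q^{i+1}(S∪{i})·M_P^i(S)| ∕ M_Q^i(S) ≤ n·2^n·(2ρ)` — each term `≤ 2ρ` (§1; both marginal events are class sets), `Σ_{i<n} 2^i ≤ n·2^n` terms. -/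
theorem condGapSum_le_of_classSetGap (hQ : ∀ R ⊆ Finset.range n, 0 ≤ Q R) {ρ : ℝ}
    (hgap : ∀ 𝒮 ⊆ (Finset.range n).powerset, |∑ R ∈ 𝒮, P R - ∑ R ∈ 𝒮, Q R| ≤ ρ) :
    ∑ i ∈ Finset.range n, ∑ S ∈ (Finset.range i).powerset,
        |(∑ R ∈ (Finset.range n).powerset.filter (fun R => R ∩ Finset.range (i + 1) = insert i S), P R) *
            (∑ R ∈ (Finset.range n).powerset.filter (fun R => R ∩ Finset.range i = S), Q R) -
          (∑ R ∈ (Finset.range n).powerset.filter (fun R => R ∩ Finset.range (i + 1) = insert i S), Q R) *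
            (∑ R ∈ (Finset.range n).powerset.filter (fun R => R ∩ Finset.range i = S), P R)| /
          ∑ R ∈ (Finset.range n).powerset.filter (fun R => R ∩ Finset.range i = S), Q R ≤ n * 2 ^ n * (2 * ρ) := by
  have hρ : 0 ≤ ρ := (abs_nonneg _).trans (hgap ∅ (Finset.empty_subset _))
  have hterm : ∀ i ∈ Finset.range n, ∀ S ∈ (Finset.range i).powerset,
      |(∑ R ∈ (Finset.range n).powerset.filter (fun R => R ∩ Finset.range (i + 1) = insert i S), P R) *
          (∑ R ∈ (Finset.range n).powerset.filter (fun R => R ∩ Finset.range i = S), Q R) -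
        (∑ R ∈ (Finset.range n).powerset.filter (fun R => R ∩ Finset.range (i + 1) = insert i S), Q R) *
          (∑ R ∈ (Finset.range n).powerset.filter (fun R => R ∩ Finset.range i = S), P R)| /
        ∑ R ∈ (Finset.range n).powerset.filter (fun R => R ∩ Finset.range i = S), Q R ≤ 2 * ρ := by
    intro i _ S hS
    have hS' := Finset.mem_powerset.1 hS
    exact condGap_le_two_mul_of_gaps (hgap _ (Finset.filter_subset _ _)) (hgap _ (Finset.filter_subset _ _))
      (marginal_nonneg n Q hQ (i + 1) (insert i S)) (marginal_succ_insert_le n Q hQ hS')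
  calc _ ≤ ∑ i ∈ Finset.range n, ∑ _S ∈ (Finset.range i).powerset, 2 * ρ := Finset.sum_le_sum fun i hi => Finset.sum_le_sum fun S hS => hterm i hi S hS
    _ = ∑ i ∈ Finset.range n, (2 : ℝ) ^ i * (2 * ρ) := Finset.sum_congr rfl fun i _ => by
        rw [Finset.sum_const, Finset.card_powerset, Finset.card_range, nsmul_eq_mul]; push_cast; ring
    _ ≤ ∑ _i ∈ Finset.range n, (2 : ℝ) ^ n * (2 * ρ) := Finset.sum_le_sum fun i hi =>
        mul_le_mul_of_nonneg_right (pow_le_pow_right₀ (by norm_num) (Finset.mem_range.1 hi).le) (by linarith)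
    _ = n * 2 ^ n * (2 * ρ) := by rw [Finset.sum_const, Finset.card_range, nsmul_eq_mul]; ring

/-- … and conversely (FILE V + FILE A): for non-negative `P, Q` with EQUAL totals, every class-set gap is at most HALF the ℓ¹ distance, hence at most the conditional sum. [folklore] -/
theorem classSetGap_le_condGapSum (hP : ∀ R ⊆ Finset.range n, 0 ≤ P R) (hQ : ∀ R ⊆ Finset.range n, 0 ≤ Q R)
    (htot : ∑ R ∈ (Finset.range n).powerset, P R = ∑ R ∈ (Finset.range n).powerset, Q R) (𝒮 : Finset (Finset ℕ)) (h𝒮 : 𝒮 ⊆ (Finset.range n).powerset) :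
    |∑ R ∈ 𝒮, P R - ∑ R ∈ 𝒮, Q R| ≤
      ∑ i ∈ Finset.range n, ∑ S ∈ (Finset.range i).powerset,
        |(∑ R ∈ (Finset.range n).powerset.filter (fun R => R ∩ Finset.range (i + 1) = insert i S), P R) *
            (∑ R ∈ (Finset.range n).powerset.filter (fun R => R ∩ Finset.range i = S), Q R) -
          (∑ R ∈ (Finset.range n).powerset.filter (fun R => R ∩ Finset.range (i + 1) = insert i S), Q R) *
            (∑ R ∈ (Finset.range n).powerset.filter (fun R => R ∩ Finset.range i = S), P R)| /
          ∑ R ∈ (Finset.range n).powerset.filter (fun R => R ∩ Finset.range i = S), Q R := by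
  have hV := l1_le_of_avgCondGap_marginals n P Q hP hQ
  rw [htot, sub_self, abs_zero, zero_add] at hV
  have hhalf := abs_sub_le_half_sum_abs (Finset.range n).powerset (a := P) (b := Q) htot h𝒮
  have hcomm : ∑ S ∈ (Finset.range n).powerset, |Q S - P S| = ∑ S ∈ (Finset.range n).powerset, |P S - Q S| := Finset.sum_congr rfl fun S _ => abs_sub_comm _ _
  rw [hcomm] at hhalf
  rw [abs_sub_comm]
  linarith

end OneScale

/-! ## §3 Along `K`, in the tree's class-law currency -/

section AlongK

variable {l₀ vol : ℝ} (n : ℕ → ℕ) (A B : ℕ → ℝ → Finset ℕ → ℝ)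

/-- ★★★ **NECESSITY, TERMWISE AND SUMMED** [folklore ∕ bookkeeping]: if SOME `(Bad, W, shA, shB, Wsh, δ)` give node U5's `HybridNE7` on non-negative class weights `A_K(t,·), B_K(t,·)`
over the configurations `S ⊆ range n_K` (positive totals), then dag-n20-w4's summable class-law radius `ρ_K < 1` bounds the NORMALISED conditional sum at every `|t| ≤ l₀` by
`n_K·2^{n_K}·(2ρ_K)`; at a window of BOUNDED size `n_K ≤ N` this is `≤ (N·2^N·2)·ρ_K`, a SUMMABLE letter — the conditional tower letter of FILES T∕V is NECESSARY for stub 2's dials there. -/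
theorem exists_summable_condGapSum_of_exists_hybridNE7 {N : ℕ} (hn : ∀ K, n K ≤ N)
    (hB : ∀ (K : ℕ) (t : ℝ), |t| ≤ l₀ → ∀ S ∈ (Finset.range (n K)).powerset, 0 ≤ B K t S)
    (hZA : ∀ (K : ℕ) (t : ℝ), |t| ≤ l₀ → 0 < ∑ S ∈ (Finset.range (n K)).powerset, A K t S)
    (hZB : ∀ (K : ℕ) (t : ℝ), |t| ≤ l₀ → 0 < ∑ S ∈ (Finset.range (n K)).powerset, B K t S)
    (h : ∃ (Bad : ℕ → ℝ → Finset (Finset ℕ)) (W : ℕ → ℝ) (shA shB : ℕ → ℝ → Finset ℕ → ℝ) (Wsh δ : ℕ → ℝ),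
      HybridNE7 l₀ vol (fun K => (Finset.range (n K)).powerset) A B Bad W shA shB Wsh δ) :
    ∃ γ : ℕ → ℝ, (∀ K, 0 ≤ γ K) ∧ Summable γ ∧ ∀ (K : ℕ) (t : ℝ), |t| ≤ l₀ →
      ∑ i ∈ Finset.range (n K), ∑ S ∈ (Finset.range i).powerset,
        |(∑ R ∈ (Finset.range (n K)).powerset.filter (fun R => R ∩ Finset.range (i + 1) = insert i S), A K t R / ∑ R' ∈ (Finset.range (n K)).powerset, A K t R') *
            (∑ R ∈ (Finset.range (n K)).powerset.filter (fun R => R ∩ Finset.range i = S), B K t R / ∑ R' ∈ (Finset.range (n K)).powerset, B K t R') -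
          (∑ R ∈ (Finset.range (n K)).powerset.filter (fun R => R ∩ Finset.range (i + 1) = insert i S), B K t R / ∑ R' ∈ (Finset.range (n K)).powerset, B K t R') *
            (∑ R ∈ (Finset.range (n K)).powerset.filter (fun R => R ∩ Finset.range i = S), A K t R / ∑ R' ∈ (Finset.range (n K)).powerset, A K t R')| /
          ∑ R ∈ (Finset.range (n K)).powerset.filter (fun R => R ∩ Finset.range i = S), B K t R / ∑ R' ∈ (Finset.range (n K)).powerset, B K t R' ≤ γ K := by
  obtain ⟨Bad, W, shA, shB, Wsh, δ, hH⟩ := h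
  obtain ⟨ρ, hρ01, hρs, hρ⟩ := exists_tvRadius_of_hybridNE7 hH hZA hZB
  have hsum : Summable fun K => (N : ℝ) * 2 ^ N * (2 * ρ K) := (hρs.mul_left ((N : ℝ) * 2 ^ N * 2)).congr fun K => by ring
  refine ⟨fun K => (N : ℝ) * 2 ^ N * (2 * ρ K), fun K => by have := (hρ01 K).1; positivity, hsum, fun K t ht => ?_⟩
  -- the normalised laws at `(K, t)`
  have hq : ∀ R ⊆ Finset.range (n K), 0 ≤ B K t R / ∑ R' ∈ (Finset.range (n K)).powerset, B K t R' :=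
    fun R hR => div_nonneg (hB K t ht R (Finset.mem_powerset.2 hR)) (hZB K t ht).le
  have hgap : ∀ 𝒮 ⊆ (Finset.range (n K)).powerset, |∑ R ∈ 𝒮, A K t R / ∑ R' ∈ (Finset.range (n K)).powerset, A K t R' -
      ∑ R ∈ 𝒮, B K t R / ∑ R' ∈ (Finset.range (n K)).powerset, B K t R'| ≤ ρ K := fun 𝒮 h𝒮 => by
    rw [← Finset.sum_div, ← Finset.sum_div]; exact hρ K t ht 𝒮 h𝒮
  have h1 := condGapSum_le_of_classSetGap (n K) (fun R => A K t R / ∑ R' ∈ (Finset.range (n K)).powerset, A K t R')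
    (fun R => B K t R / ∑ R' ∈ (Finset.range (n K)).powerset, B K t R') hq hgap
  refine h1.trans ?_
  have hρ0 : 0 ≤ 2 * ρ K := by linarith [(hρ01 K).1]
  have hnN : (n K : ℝ) * 2 ^ n K ≤ N * 2 ^ N :=
    mul_le_mul (by exact_mod_cast hn K) (pow_le_pow_right₀ (by norm_num) (hn K)) (by positivity) (Nat.cast_nonneg _)
  exact mul_le_mul_of_nonneg_right hnN hρ0

/-- ★★ **NECESSITY TERMWISE, ANY WINDOW SIZE** [folklore ∕ bookkeeping]: if SOME dials give `HybridNE7` (run-B weights non-negative, totals positive), then with dag-n20-w4's summable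
radius `ρ` EVERY single mass-weighted conditional two-run discrepancy — level `i`, past configuration `S ⊆ range i`, any `K`, any `|t| ≤ l₀`, whatever the block count `n_K` — is
`≤ 2ρ_K`: ONE level and ONE past configuration with an unsummable (in `K`) normalised conditional gap kill every dial.  The refuter's test in conditional currency. -/
theorem exists_radius_condGap_le_of_exists_hybridNE7
    (hB : ∀ (K : ℕ) (t : ℝ), |t| ≤ l₀ → ∀ S ∈ (Finset.range (n K)).powerset, 0 ≤ B K t S)
    (hZA : ∀ (K : ℕ) (t : ℝ), |t| ≤ l₀ → 0 < ∑ S ∈ (Finset.range (n K)).powerset, A K t S)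
    (hZB : ∀ (K : ℕ) (t : ℝ), |t| ≤ l₀ → 0 < ∑ S ∈ (Finset.range (n K)).powerset, B K t S)
    (h : ∃ (Bad : ℕ → ℝ → Finset (Finset ℕ)) (W : ℕ → ℝ) (shA shB : ℕ → ℝ → Finset ℕ → ℝ) (Wsh δ : ℕ → ℝ),
      HybridNE7 l₀ vol (fun K => (Finset.range (n K)).powerset) A B Bad W shA shB Wsh δ) :
    ∃ ρ : ℕ → ℝ, (∀ K, 0 ≤ ρ K ∧ ρ K < 1) ∧ Summable ρ ∧ ∀ (K : ℕ) (t : ℝ), |t| ≤ l₀ → ∀ (i : ℕ) (S : Finset ℕ), S ⊆ Finset.range i →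
      |(∑ R ∈ (Finset.range (n K)).powerset.filter (fun R => R ∩ Finset.range (i + 1) = insert i S), A K t R / ∑ R' ∈ (Finset.range (n K)).powerset, A K t R') *
          (∑ R ∈ (Finset.range (n K)).powerset.filter (fun R => R ∩ Finset.range i = S), B K t R / ∑ R' ∈ (Finset.range (n K)).powerset, B K t R') -
        (∑ R ∈ (Finset.range (n K)).powerset.filter (fun R => R ∩ Finset.range (i + 1) = insert i S), B K t R / ∑ R' ∈ (Finset.range (n K)).powerset, B K t R') *
          (∑ R ∈ (Finset.range (n K)).powerset.filter (fun R => R ∩ Finset.range i = S), A K t R / ∑ R' ∈ (Finset.range (n K)).powerset, A K t R')| /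
        ∑ R ∈ (Finset.range (n K)).powerset.filter (fun R => R ∩ Finset.range i = S), B K t R / ∑ R' ∈ (Finset.range (n K)).powerset, B K t R' ≤ 2 * ρ K := by
  obtain ⟨Bad, W, shA, shB, Wsh, δ, hH⟩ := h
  obtain ⟨ρ, hρ01, hρs, hρ⟩ := exists_tvRadius_of_hybridNE7 hH hZA hZB
  refine ⟨ρ, hρ01, hρs, fun K t ht i S hS => ?_⟩
  have hq : ∀ R ⊆ Finset.range (n K), 0 ≤ B K t R / ∑ R' ∈ (Finset.range (n K)).powerset, B K t R' :=
    fun R hR => div_nonneg (hB K t ht R (Finset.mem_powerset.2 hR)) (hZB K t ht).le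
  have hgap : ∀ 𝒮 ⊆ (Finset.range (n K)).powerset, |∑ R ∈ 𝒮, A K t R / ∑ R' ∈ (Finset.range (n K)).powerset, A K t R' -
      ∑ R ∈ 𝒮, B K t R / ∑ R' ∈ (Finset.range (n K)).powerset, B K t R'| ≤ ρ K := fun 𝒮 h𝒮 => by
    rw [← Finset.sum_div, ← Finset.sum_div]; exact hρ K t ht 𝒮 h𝒮
  exact condGap_le_two_mul_of_gaps (hgap _ (Finset.filter_subset _ _)) (hgap _ (Finset.filter_subset _ _))
    (marginal_nonneg (n K) _ hq (i + 1) (insert i S)) (marginal_succ_insert_le (n K) _ hq hS)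

/-- ★★★ **SUFFICIENCY, TOWER-FREE** [folklore ∕ bookkeeping]: non-negative class weights `A, B` over the configurations `S ⊆ range n_K` with positive totals, the E1∕E2 dictionary to `Z`, node U5's
`Target vol l₀ δ Z`, and a bound `γ_K` on HALF the NORMALISED conditional sum of FILE V at every `|t| ≤ l₀`, with `γ` summable and `γ_K < 1`, give SOME shells with
`HybridNE7 l₀ vol T A B ∅ 0 shA shB γ δ` — FILE V's `l1_le_of_avgCondGap_marginals` (equal totals `1`) + FILE A's half-ℓ¹ bound + dag-n20-w4's class-law road.  NO independence,
NO tower to supply. -/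
theorem exists_hybridNE7_of_target_of_condGapSum (hl₀ : 0 ≤ l₀)
    (hA : ∀ (K : ℕ) (t : ℝ), |t| ≤ l₀ → ∀ S ∈ (Finset.range (n K)).powerset, 0 ≤ A K t S)
    (hB : ∀ (K : ℕ) (t : ℝ), |t| ≤ l₀ → ∀ S ∈ (Finset.range (n K)).powerset, 0 ≤ B K t S)
    (hZA : ∀ (K : ℕ) (t : ℝ), |t| ≤ l₀ → 0 < ∑ S ∈ (Finset.range (n K)).powerset, A K t S)
    (hZB : ∀ (K : ℕ) (t : ℝ), |t| ≤ l₀ → 0 < ∑ S ∈ (Finset.range (n K)).powerset, B K t S)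
    {Z : ℕ → ℝ → ℝ} (hZA' : ∀ (K : ℕ) (t : ℝ), |t| ≤ l₀ → Z K t = ∑ S ∈ (Finset.range (n K)).powerset, A K t S)
    (hZB' : ∀ (K : ℕ) (t : ℝ), |t| ≤ l₀ → Z (K + 1) t = ∑ S ∈ (Finset.range (n K)).powerset, B K t S) {δ : ℕ → ℝ} (hT : Target vol l₀ δ Z)
    {γ : ℕ → ℝ} (hγ0 : ∀ K, 0 ≤ γ K) (hγ1 : ∀ K, γ K < 1) (hγs : Summable γ)
    (hcond : ∀ (K : ℕ) (t : ℝ), |t| ≤ l₀ →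
      ∑ i ∈ Finset.range (n K), ∑ S ∈ (Finset.range i).powerset,
        |(∑ R ∈ (Finset.range (n K)).powerset.filter (fun R => R ∩ Finset.range (i + 1) = insert i S), A K t R / ∑ R' ∈ (Finset.range (n K)).powerset, A K t R') *
            (∑ R ∈ (Finset.range (n K)).powerset.filter (fun R => R ∩ Finset.range i = S), B K t R / ∑ R' ∈ (Finset.range (n K)).powerset, B K t R') -
          (∑ R ∈ (Finset.range (n K)).powerset.filter (fun R => R ∩ Finset.range (i + 1) = insert i S), B K t R / ∑ R' ∈ (Finset.range (n K)).powerset, B K t R') *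
            (∑ R ∈ (Finset.range (n K)).powerset.filter (fun R => R ∩ Finset.range i = S), A K t R / ∑ R' ∈ (Finset.range (n K)).powerset, A K t R')| /
          ∑ R ∈ (Finset.range (n K)).powerset.filter (fun R => R ∩ Finset.range i = S), B K t R / ∑ R' ∈ (Finset.range (n K)).powerset, B K t R' ≤ γ K) :
    ∃ shA shB : ℕ → ℝ → Finset ℕ → ℝ, HybridNE7 l₀ vol (fun K => (Finset.range (n K)).powerset) A B (fun _ _ => ∅) (fun _ => 0) shA shB γ δ := by
  refine exists_hybridNE7_of_target_of_classLawTV (T := fun K => (Finset.range (n K)).powerset) hl₀ hA hB hZA hZB hZA' hZB' hT hγ0 hγ1 hγs fun K t ht 𝒮 h𝒮 => ?_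
  have hp : ∀ R ⊆ Finset.range (n K), 0 ≤ A K t R / ∑ R' ∈ (Finset.range (n K)).powerset, A K t R' :=
    fun R hR => div_nonneg (hA K t ht R (Finset.mem_powerset.2 hR)) (hZA K t ht).le
  have hq : ∀ R ⊆ Finset.range (n K), 0 ≤ B K t R / ∑ R' ∈ (Finset.range (n K)).powerset, B K t R' :=
    fun R hR => div_nonneg (hB K t ht R (Finset.mem_powerset.2 hR)) (hZB K t ht).le
  have htot : ∑ R ∈ (Finset.range (n K)).powerset, A K t R / ∑ R' ∈ (Finset.range (n K)).powerset, A K t R' =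
      ∑ R ∈ (Finset.range (n K)).powerset, B K t R / ∑ R' ∈ (Finset.range (n K)).powerset, B K t R' := by
    rw [← Finset.sum_div, ← Finset.sum_div, div_self (hZA K t ht).ne', div_self (hZB K t ht).ne']
  have h := classSetGap_le_condGapSum (n K) (fun R => A K t R / ∑ R' ∈ (Finset.range (n K)).powerset, A K t R')
    (fun R => B K t R / ∑ R' ∈ (Finset.range (n K)).powerset, B K t R') hp hq htot 𝒮 h𝒮
  rw [← Finset.sum_div, ← Finset.sum_div] at h
  exact h.trans (hcond K t ht)

/-- ★★ **AT A BOUNDED WINDOW THE TWO LETTERS ARE ONE** [folklore ∕ bookkeeping]: for non-negative class weights over the configurations of `n_K ≤ N` blocks with positive totals,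
«a summable `ρ` bounds every class-set gap of the normalised laws at every `|t| ≤ l₀`» (dag-n20-w4's class-law TV letter) ⟺ «a summable `γ` bounds the normalised mass-weighted
conditional sum at every `|t| ≤ l₀`» (the letter of FILES T∕V) — constants `N·2^N·2` one way, `1` the other. -/
theorem classSetGapLetter_iff_condGapSumLetter_of_boundedBlocks {N : ℕ} (hn : ∀ K, n K ≤ N)
    (hA : ∀ (K : ℕ) (t : ℝ), |t| ≤ l₀ → ∀ S ∈ (Finset.range (n K)).powerset, 0 ≤ A K t S)
    (hB : ∀ (K : ℕ) (t : ℝ), |t| ≤ l₀ → ∀ S ∈ (Finset.range (n K)).powerset, 0 ≤ B K t S)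
    (hZA : ∀ (K : ℕ) (t : ℝ), |t| ≤ l₀ → 0 < ∑ S ∈ (Finset.range (n K)).powerset, A K t S)
    (hZB : ∀ (K : ℕ) (t : ℝ), |t| ≤ l₀ → 0 < ∑ S ∈ (Finset.range (n K)).powerset, B K t S) :
    (∃ ρ : ℕ → ℝ, (∀ K, 0 ≤ ρ K) ∧ Summable ρ ∧ ∀ (K : ℕ) (t : ℝ), |t| ≤ l₀ → ∀ 𝒮 ⊆ (Finset.range (n K)).powerset,
      |(∑ S ∈ 𝒮, A K t S) / (∑ S ∈ (Finset.range (n K)).powerset, A K t S) - (∑ S ∈ 𝒮, B K t S) / (∑ S ∈ (Finset.range (n K)).powerset, B K t S)| ≤ ρ K) ↔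
    (∃ γ : ℕ → ℝ, (∀ K, 0 ≤ γ K) ∧ Summable γ ∧ ∀ (K : ℕ) (t : ℝ), |t| ≤ l₀ →
      ∑ i ∈ Finset.range (n K), ∑ S ∈ (Finset.range i).powerset,
        |(∑ R ∈ (Finset.range (n K)).powerset.filter (fun R => R ∩ Finset.range (i + 1) = insert i S), A K t R / ∑ R' ∈ (Finset.range (n K)).powerset, A K t R') *
            (∑ R ∈ (Finset.range (n K)).powerset.filter (fun R => R ∩ Finset.range i = S), B K t R / ∑ R' ∈ (Finset.range (n K)).powerset, B K t R') -
          (∑ R ∈ (Finset.range (n K)).powerset.filter (fun R => R ∩ Finset.range (i + 1) = insert i S), B K t R / ∑ R' ∈ (Finset.range (n K)).powerset, B K t R') *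
            (∑ R ∈ (Finset.range (n K)).powerset.filter (fun R => R ∩ Finset.range i = S), A K t R / ∑ R' ∈ (Finset.range (n K)).powerset, A K t R')| /
          ∑ R ∈ (Finset.range (n K)).powerset.filter (fun R => R ∩ Finset.range i = S), B K t R / ∑ R' ∈ (Finset.range (n K)).powerset, B K t R' ≤ γ K) := by
  have hp : ∀ (K : ℕ) (t : ℝ), |t| ≤ l₀ → ∀ R ⊆ Finset.range (n K), 0 ≤ A K t R / ∑ R' ∈ (Finset.range (n K)).powerset, A K t R' :=
    fun K t ht R hR => div_nonneg (hA K t ht R (Finset.mem_powerset.2 hR)) (hZA K t ht).le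
  have hq : ∀ (K : ℕ) (t : ℝ), |t| ≤ l₀ → ∀ R ⊆ Finset.range (n K), 0 ≤ B K t R / ∑ R' ∈ (Finset.range (n K)).powerset, B K t R' :=
    fun K t ht R hR => div_nonneg (hB K t ht R (Finset.mem_powerset.2 hR)) (hZB K t ht).le
  constructor
  · rintro ⟨ρ, hρ0, hρs, hρ⟩
    have hsum : Summable fun K => (N : ℝ) * 2 ^ N * (2 * ρ K) := (hρs.mul_left ((N : ℝ) * 2 ^ N * 2)).congr fun K => by ring
    refine ⟨fun K => (N : ℝ) * 2 ^ N * (2 * ρ K), fun K => by have := hρ0 K; positivity, hsum, fun K t ht => ?_⟩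
    have hgap : ∀ 𝒮 ⊆ (Finset.range (n K)).powerset, |∑ R ∈ 𝒮, A K t R / ∑ R' ∈ (Finset.range (n K)).powerset, A K t R' -
        ∑ R ∈ 𝒮, B K t R / ∑ R' ∈ (Finset.range (n K)).powerset, B K t R'| ≤ ρ K := fun 𝒮 h𝒮 => by
      rw [← Finset.sum_div, ← Finset.sum_div]; exact hρ K t ht 𝒮 h𝒮
    refine (condGapSum_le_of_classSetGap (n K) _ _ (hq K t ht) hgap).trans ?_
    have hnN : (n K : ℝ) * 2 ^ n K ≤ N * 2 ^ N :=
      mul_le_mul (by exact_mod_cast hn K) (pow_le_pow_right₀ (by norm_num) (hn K)) (by positivity) (Nat.cast_nonneg _)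
    exact mul_le_mul_of_nonneg_right hnN (by linarith [hρ0 K])
  · rintro ⟨γ, hγ0, hγs, hγ⟩
    refine ⟨γ, hγ0, hγs, fun K t ht 𝒮 h𝒮 => ?_⟩
    have htot : ∑ R ∈ (Finset.range (n K)).powerset, A K t R / ∑ R' ∈ (Finset.range (n K)).powerset, A K t R' =
        ∑ R ∈ (Finset.range (n K)).powerset, B K t R / ∑ R' ∈ (Finset.range (n K)).powerset, B K t R' := by
      rw [← Finset.sum_div, ← Finset.sum_div, div_self (hZA K t ht).ne', div_self (hZB K t ht).ne']
    have h := classSetGap_le_condGapSum (n K) _ _ (hp K t ht) (hq K t ht) htot 𝒮 h𝒮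
    rw [← Finset.sum_div, ← Finset.sum_div] at h
    exact h.trans (hγ K t ht)

end AlongK

/-! ## §4 (v1.1) The necessity constant is LINEAR in the window size: per level, data processing controls all `2^i` conditional terms together -/

section Linear
open Summit.QuantumFields.YangMills.BalabanUVNodes.N20InhomogeneousBlockCaricature (sum_abs_sub_le_two_mul_of_classSetGap_le)
variable (n : ℕ) (P Q : Finset ℕ → ℝ)

/-- ONE TERM, ADDITIVE FORM [folklore]: `0 ≤ b₁ ≤ b₀` ⇒ `|a₁·b₀ − b₁·a₀| ∕ b₀ ≤ |a₁ − b₁| + |a₀ − b₀|` (the quotient is `0` when `b₀ = 0`). -/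
theorem condGap_le_abs_sub_add_abs_sub {a₀ a₁ b₀ b₁ : ℝ} (hb1 : 0 ≤ b₁) (hb10 : b₁ ≤ b₀) :
    |a₁ * b₀ - b₁ * a₀| / b₀ ≤ |a₁ - b₁| + |a₀ - b₀| := by
  rcases (hb1.trans hb10).eq_or_lt with hb0 | hb0
  · rw [← hb0, div_zero]; positivity
  · rw [div_le_iff₀ hb0]
    calc |a₁ * b₀ - b₁ * a₀| = |(a₁ - b₁) * b₀ + b₁ * (b₀ - a₀)| := by ring_nf
      _ ≤ |(a₁ - b₁) * b₀| + |b₁ * (b₀ - a₀)| := abs_add_le _ _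
      _ = |a₁ - b₁| * b₀ + b₁ * |a₀ - b₀| := by rw [abs_mul, abs_mul, abs_of_pos hb0, abs_of_nonneg hb1, abs_sub_comm b₀ a₀]
      _ ≤ |a₁ - b₁| * b₀ + b₀ * |a₀ - b₀| := by gcongr
      _ = (|a₁ - b₁| + |a₀ - b₀|) * b₀ := by ring

/-- **DATA PROCESSING FOR THE LEVEL-`i` MARGINALS** [folklore]: `Σ_{S⊆range i} |M_P^i(S) − M_Q^i(S)| ≤ Σ_{R⊆range n} |P(R) − Q(R)|` — the fibres `{R : R ∩ range i = S}`, `S ⊆ range i`,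
partition the configurations (`Finset.sum_fiberwise_of_maps_to` with `R ↦ R ∩ range i`). -/
theorem sum_marginal_abs_sub_le_l1 (i : ℕ) :
    ∑ S ∈ (Finset.range i).powerset, |(∑ R ∈ (Finset.range n).powerset.filter (fun R => R ∩ Finset.range i = S), P R) -
        ∑ R ∈ (Finset.range n).powerset.filter (fun R => R ∩ Finset.range i = S), Q R| ≤ ∑ R ∈ (Finset.range n).powerset, |P R - Q R| := by
  have hmaps : ∀ R ∈ (Finset.range n).powerset, R ∩ Finset.range i ∈ (Finset.range i).powerset :=
    fun R _ => Finset.mem_powerset.2 Finset.inter_subset_right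
  rw [← Finset.sum_fiberwise_of_maps_to hmaps (fun R => |P R - Q R|)]
  refine Finset.sum_le_sum fun S _ => ?_
  rw [← Finset.sum_sub_distrib]
  exact Finset.abs_sum_le_sum_abs _ _

/-- **… AND FOR THE `S ∪ {i}` FAMILY AT LEVEL `i + 1`** [folklore]: `Σ_{S⊆range i} |M_P^{i+1}(S∪{i}) − M_Q^{i+1}(S∪{i})| ≤ Σ_{R⊆range n} |P(R) − Q(R)|` (`S ↦ S ∪ {i}` is injective on
`(range i).powerset` into `(range (i+1)).powerset`; then the previous lemma at level `i + 1`). -/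
theorem sum_marginal_insert_abs_sub_le_l1 (i : ℕ) :
    ∑ S ∈ (Finset.range i).powerset, |(∑ R ∈ (Finset.range n).powerset.filter (fun R => R ∩ Finset.range (i + 1) = insert i S), P R) -
        ∑ R ∈ (Finset.range n).powerset.filter (fun R => R ∩ Finset.range (i + 1) = insert i S), Q R| ≤ ∑ R ∈ (Finset.range n).powerset, |P R - Q R| := by
  have hinj : Set.InjOn (fun S : Finset ℕ => insert i S) ↑((Finset.range i).powerset) := by
    intro S hS S' hS' h
    have hiS : i ∉ S := fun h' => Finset.notMem_range_self (Finset.mem_powerset.1 (Finset.mem_coe.1 hS) h')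
    have hiS' : i ∉ S' := fun h' => Finset.notMem_range_self (Finset.mem_powerset.1 (Finset.mem_coe.1 hS') h')
    have := congrArg (fun T : Finset ℕ => T.erase i) h
    simpa only [Finset.erase_insert hiS, Finset.erase_insert hiS'] using this
  have himg : ((Finset.range i).powerset).image (fun S => insert i S) ⊆ (Finset.range (i + 1)).powerset := by
    intro S' hS'
    obtain ⟨S, hS, rfl⟩ := Finset.mem_image.1 hS'
    rw [Finset.mem_powerset, Finset.range_add_one]
    exact Finset.insert_subset_insert i (Finset.mem_powerset.1 hS)
  calc _ = ∑ S' ∈ ((Finset.range i).powerset).image (fun S => insert i S),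
        |(∑ R ∈ (Finset.range n).powerset.filter (fun R => R ∩ Finset.range (i + 1) = S'), P R) -
          ∑ R ∈ (Finset.range n).powerset.filter (fun R => R ∩ Finset.range (i + 1) = S'), Q R| := (Finset.sum_image hinj).symm
    _ ≤ ∑ S' ∈ (Finset.range (i + 1)).powerset, |(∑ R ∈ (Finset.range n).powerset.filter (fun R => R ∩ Finset.range (i + 1) = S'), P R) -
          ∑ R ∈ (Finset.range n).powerset.filter (fun R => R ∩ Finset.range (i + 1) = S'), Q R| :=
        Finset.sum_le_sum_of_subset_of_nonneg himg fun _ _ _ => abs_nonneg _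
    _ ≤ _ := sum_marginal_abs_sub_le_l1 n P Q (i + 1)

/-- ★★ **THE CONDITIONAL SUM IS `≤ 4n·ρ` — LINEAR IN THE WINDOW SIZE** [folklore ∕ bookkeeping]: for non-negative `P, Q` on `(range n).powerset` with equal totals whose every class-set gap is
`≤ ρ`, the mass-weighted conditional sum of FILE V is `≤ n·(2·(2ρ))`: per level the terms add up to at most `2·ℓ¹(P, Q) ≤ 2·2ρ` (§4's two data-processing lemmas + FILE Q's
`sum_abs_sub_le_two_mul_of_classSetGap_le`).  v1.0's `condGapSum_le_of_classSetGap` had `n·2^n·2ρ`. -/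
theorem condGapSum_le_linear_of_classSetGap (hQ : ∀ R ⊆ Finset.range n, 0 ≤ Q R)
    (htot : ∑ R ∈ (Finset.range n).powerset, P R = ∑ R ∈ (Finset.range n).powerset, Q R) {ρ : ℝ}
    (hgap : ∀ 𝒮 ⊆ (Finset.range n).powerset, |∑ R ∈ 𝒮, P R - ∑ R ∈ 𝒮, Q R| ≤ ρ) :
    ∑ i ∈ Finset.range n, ∑ S ∈ (Finset.range i).powerset,
        |(∑ R ∈ (Finset.range n).powerset.filter (fun R => R ∩ Finset.range (i + 1) = insert i S), P R) *
            (∑ R ∈ (Finset.range n).powerset.filter (fun R => R ∩ Finset.range i = S), Q R) -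
          (∑ R ∈ (Finset.range n).powerset.filter (fun R => R ∩ Finset.range (i + 1) = insert i S), Q R) *
            (∑ R ∈ (Finset.range n).powerset.filter (fun R => R ∩ Finset.range i = S), P R)| /
          ∑ R ∈ (Finset.range n).powerset.filter (fun R => R ∩ Finset.range i = S), Q R ≤ n * (2 * (2 * ρ)) := by
  have hl1 : ∑ R ∈ (Finset.range n).powerset, |P R - Q R| ≤ 2 * ρ :=
    sum_abs_sub_le_two_mul_of_classSetGap_le (Finset.range n).powerset (a := Q) (b := P) htot.symm fun 𝒮 h𝒮 => hgap 𝒮 h𝒮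
  have hlevel : ∀ i ∈ Finset.range n, ∑ S ∈ (Finset.range i).powerset,
      |(∑ R ∈ (Finset.range n).powerset.filter (fun R => R ∩ Finset.range (i + 1) = insert i S), P R) *
          (∑ R ∈ (Finset.range n).powerset.filter (fun R => R ∩ Finset.range i = S), Q R) -
        (∑ R ∈ (Finset.range n).powerset.filter (fun R => R ∩ Finset.range (i + 1) = insert i S), Q R) *
          (∑ R ∈ (Finset.range n).powerset.filter (fun R => R ∩ Finset.range i = S), P R)| /
        ∑ R ∈ (Finset.range n).powerset.filter (fun R => R ∩ Finset.range i = S), Q R ≤ 2 * (2 * ρ) := by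
    intro i _
    calc _ ≤ ∑ S ∈ (Finset.range i).powerset,
          (|(∑ R ∈ (Finset.range n).powerset.filter (fun R => R ∩ Finset.range (i + 1) = insert i S), P R) -
              ∑ R ∈ (Finset.range n).powerset.filter (fun R => R ∩ Finset.range (i + 1) = insert i S), Q R| +
            |(∑ R ∈ (Finset.range n).powerset.filter (fun R => R ∩ Finset.range i = S), P R) -
              ∑ R ∈ (Finset.range n).powerset.filter (fun R => R ∩ Finset.range i = S), Q R|) :=
          Finset.sum_le_sum fun S hS => condGap_le_abs_sub_add_abs_sub (marginal_nonneg n Q hQ (i + 1) (insert i S))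
            (marginal_succ_insert_le n Q hQ (Finset.mem_powerset.1 hS))
      _ ≤ 2 * ρ + 2 * ρ := by
          rw [Finset.sum_add_distrib]
          exact add_le_add ((sum_marginal_insert_abs_sub_le_l1 n P Q i).trans hl1) ((sum_marginal_abs_sub_le_l1 n P Q i).trans hl1)
      _ = 2 * (2 * ρ) := by ring
  calc _ ≤ ∑ _i ∈ Finset.range n, 2 * (2 * ρ) := Finset.sum_le_sum hlevel
    _ = n * (2 * (2 * ρ)) := by rw [Finset.sum_const, Finset.card_range, nsmul_eq_mul]

variable {l₀ vol : ℝ} (nb : ℕ → ℕ) (A B : ℕ → ℝ → Finset ℕ → ℝ)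
/-- ★★★ **NECESSITY WITH A LINEAR CONSTANT, ANY BLOCK COUNTS** [folklore ∕ bookkeeping]: if SOME dials give node U5's `HybridNE7` on class weights over the configurations of `n_K` blocks
(run B non-negative, totals positive), then dag-n20-w4's summable radius `ρ_K < 1` bounds the NORMALISED conditional sum at every `|t| ≤ l₀` by `n_K·(2·(2ρ_K))` —
LINEAR in the window size; so for a window growing like `n_K` the conditional letter of FILES T∕V is necessary up to the factor `4n_K`. -/
theorem exists_radius_condGapSum_le_linear_of_exists_hybridNE7
    (hB : ∀ (K : ℕ) (t : ℝ), |t| ≤ l₀ → ∀ S ∈ (Finset.range (nb K)).powerset, 0 ≤ B K t S)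
    (hZA : ∀ (K : ℕ) (t : ℝ), |t| ≤ l₀ → 0 < ∑ S ∈ (Finset.range (nb K)).powerset, A K t S)
    (hZB : ∀ (K : ℕ) (t : ℝ), |t| ≤ l₀ → 0 < ∑ S ∈ (Finset.range (nb K)).powerset, B K t S)
    (h : ∃ (Bad : ℕ → ℝ → Finset (Finset ℕ)) (W : ℕ → ℝ) (shA shB : ℕ → ℝ → Finset ℕ → ℝ) (Wsh δ : ℕ → ℝ),
      HybridNE7 l₀ vol (fun K => (Finset.range (nb K)).powerset) A B Bad W shA shB Wsh δ) :
    ∃ ρ : ℕ → ℝ, (∀ K, 0 ≤ ρ K ∧ ρ K < 1) ∧ Summable ρ ∧ ∀ (K : ℕ) (t : ℝ), |t| ≤ l₀ →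
      ∑ i ∈ Finset.range (nb K), ∑ S ∈ (Finset.range i).powerset,
        |(∑ R ∈ (Finset.range (nb K)).powerset.filter (fun R => R ∩ Finset.range (i + 1) = insert i S), A K t R / ∑ R' ∈ (Finset.range (nb K)).powerset, A K t R') *
            (∑ R ∈ (Finset.range (nb K)).powerset.filter (fun R => R ∩ Finset.range i = S), B K t R / ∑ R' ∈ (Finset.range (nb K)).powerset, B K t R') -
          (∑ R ∈ (Finset.range (nb K)).powerset.filter (fun R => R ∩ Finset.range (i + 1) = insert i S), B K t R / ∑ R' ∈ (Finset.range (nb K)).powerset, B K t R') *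
            (∑ R ∈ (Finset.range (nb K)).powerset.filter (fun R => R ∩ Finset.range i = S), A K t R / ∑ R' ∈ (Finset.range (nb K)).powerset, A K t R')| /
          ∑ R ∈ (Finset.range (nb K)).powerset.filter (fun R => R ∩ Finset.range i = S), B K t R / ∑ R' ∈ (Finset.range (nb K)).powerset, B K t R' ≤
        nb K * (2 * (2 * ρ K)) := by
  obtain ⟨Bad, W, shA, shB, Wsh, δ, hH⟩ := h
  obtain ⟨ρ, hρ01, hρs, hρ⟩ := exists_tvRadius_of_hybridNE7 hH hZA hZB
  refine ⟨ρ, hρ01, hρs, fun K t ht => ?_⟩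
  have hq : ∀ R ⊆ Finset.range (nb K), 0 ≤ B K t R / ∑ R' ∈ (Finset.range (nb K)).powerset, B K t R' :=
    fun R hR => div_nonneg (hB K t ht R (Finset.mem_powerset.2 hR)) (hZB K t ht).le
  have htot : ∑ R ∈ (Finset.range (nb K)).powerset, A K t R / ∑ R' ∈ (Finset.range (nb K)).powerset, A K t R' =
      ∑ R ∈ (Finset.range (nb K)).powerset, B K t R / ∑ R' ∈ (Finset.range (nb K)).powerset, B K t R' := by
    rw [← Finset.sum_div, ← Finset.sum_div, div_self (hZA K t ht).ne', div_self (hZB K t ht).ne']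
  have hgap : ∀ 𝒮 ⊆ (Finset.range (nb K)).powerset, |∑ R ∈ 𝒮, A K t R / ∑ R' ∈ (Finset.range (nb K)).powerset, A K t R' -
      ∑ R ∈ 𝒮, B K t R / ∑ R' ∈ (Finset.range (nb K)).powerset, B K t R'| ≤ ρ K := fun 𝒮 h𝒮 => by
    rw [← Finset.sum_div, ← Finset.sum_div]; exact hρ K t ht 𝒮 h𝒮
  exact condGapSum_le_linear_of_classSetGap (nb K) _ _ hq htot hgap

end Linear

end Summit.QuantumFields.YangMills.BalabanUVNodes.N20ClassLawConditionalWindowCriterion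

end
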